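import Summits.CriticalPhenomena.PercolationContinuityZ3.Theorems.SahiMasterFamilyCoordPoly
import Summits.CriticalPhenomena.PercolationContinuityZ3.Theorems.SahiMasterFamilyTerminalAll
import Mathlib.Tactic.Linarith
import Mathlib.Tactic.Ring
import HarnessLib

/-!
# `NoHeavyLowerTail` (crux stmt-CriticalPhenomena-4575), master-family line P2: the ONE-COORDINATE BERNSTEIN PIECES of `E_3` under a product measure,
# the local induction step, and the typed conjecture DT-EGC ("every doubly-terminal triple has a good coordinate")

Support file (seat `prim-masterthm-p2`, gen 4; `--supports stmt-CriticalPhenomena-4575`); two definitions (`coordPiece₁/₂`) and one `@[conjecture]` definition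
(`DTEGC`, an obligation of THIS programme — census-clean, not a published fact), no sorry.  Memo SAHI-ROUTE.md §4.15.

For increasing events `U_0, U_1, U_2 ⊆ 2^ι`, a product measure `p` and a coordinate `e`, `s ↦ E_3(μ_{p[e↦s]}; U)` is the cubic `Q = sahiEP (secPoly p e) 3 (1_U)`
(master-conj, `…SahiMasterFamilyCoordPoly`), with `Q(0), Q(1) = E_3` of the `e`-sections (`…SahiMasterFamilyTerminalAll`).  Writing `Q(s) = Σ c_i s^i`,
  `Q(s) = (1−s)·Q(0) + s·Q(1) + s(1−s)·[(1−s)·b₁ + s·b₂]`,  `b₁ = −(c₂ + c₃)`, `b₂ = −(c₂ + 2c₃)`  (`cubic_bernstein_decomp`)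
— the two ONE-COORDINATE BERNSTEIN PIECES (`coordPiece₁/₂`; `= 3B₁−2B₀−B₃, 3B₂−B₀−2B₃` in the degree-3 Bernstein coefficients; the cell's (L1)/(L2)-type
polarised forms).  Hence (`sahiE_three_decomp_coord`, `sahiE_three_nonneg_of_goodCoord`): if both sections have `E_3 ≥ 0` and `e` is GOOD (both pieces `≥ 0`),
then `E_3(μ_p; U) ≥ 0` — the local step of an induction on the number of coordinates.  The ∀-coordinate form (DM₃) is refuted at `k = 5` and the ∃-form for
GENERAL triples (EGC) by the hexagon (INEQ-CLAIMS l.253, l.363); the seat's census (§4.15(c): ≈ 29 000 (triple, p) cells, `k ≤ 10`, incl. the full irreducible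
doubly-terminal class of `2^[4]`, samples of `2^[5]`, all 135 coordinate-transitive doubly-terminal triples of `2^[6]`, 419 sampled ones of `2^[9]`, the hard graph rows
γ/α/T_inc/3PT on K4, C4+hub, K5−2e) finds NO doubly-terminal triple without a good coordinate, and the hexagon itself is not doubly-terminal (its two-move descent
ends at `E_3 ≡ 0`).  `DTEGC` types the conjecture; with `SahiFrontierTransfer.sahiPositive_three_iff_doublyTerminal` (p226067) and the local step it gives Kahn's
`C_3` by induction on the number of coordinates (the induction itself, which needs the type change to the sub-cube, is NOT in this file).
-/

noncomputable section

open scoped Classical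

namespace Summit.CriticalPhenomena.PercolationContinuityZ3.Theorems

namespace SahiCoordinateBernstein

open Finset Function Polynomial
open Literature.Combinatorics.Sahi2008
open Literature.Probability.Percolation.DecisionTree (ind ind_of_mem ind_of_not_mem ind_nonneg)

/-- **A cubic through its endpoint values and two Bernstein pieces**: for `deg Q ≤ 3`,
`Q(s) = (1−s)Q(0) + sQ(1) + s(1−s)[(1−s)(−c₂−c₃) + s(−c₂−2c₃)]`. [this work] -/
theorem cubic_bernstein_decomp (Q : ℝ[X]) (hQ : Q.natDegree ≤ 3) (s : ℝ) :
    Q.eval s = (1 - s) * Q.eval 0 + s * Q.eval 1 +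
      s * (1 - s) * ((1 - s) * (-(Q.coeff 2 + Q.coeff 3)) + s * (-(Q.coeff 2 + 2 * Q.coeff 3))) := by
  have hrep : ∀ x : ℝ, Q.eval x = Q.coeff 0 + Q.coeff 1 * x + Q.coeff 2 * x ^ 2 + Q.coeff 3 * x ^ 3 := by
    intro x
    conv_lhs => rw [Q.as_sum_range_C_mul_X_pow' (show Q.natDegree < 4 by omega)]
    simp only [Finset.sum_range_succ, Finset.sum_range_zero, eval_add, eval_mul, eval_C, eval_pow, eval_X, zero_add]
    ring
  rw [hrep s, hrep 0, hrep 1]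
  ring

variable {ι : Type} [Fintype ι]

/-- **First one-coordinate Bernstein piece** `b₁(e) = −(c₂ + c₃)` of the fibre cubic of `E_3(1_{U_0},1_{U_1},1_{U_2})` along `e`. [this work] -/
def coordPiece₁ (p : ι → unitInterval) (e : ι) (U : Fin 3 → Set (Set ι)) : ℝ :=
  -((sahiEP (secPoly p e) 3 (fun j => ind (U j))).coeff 2 + (sahiEP (secPoly p e) 3 (fun j => ind (U j))).coeff 3)

/-- **Second one-coordinate Bernstein piece** `b₂(e) = −(c₂ + 2c₃)`. [this work] -/
def coordPiece₂ (p : ι → unitInterval) (e : ι) (U : Fin 3 → Set (Set ι)) : ℝ :=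
  -((sahiEP (secPoly p e) 3 (fun j => ind (U j))).coeff 2 + 2 * (sahiEP (secPoly p e) 3 (fun j => ind (U j))).coeff 3)

/-- The fibre cubic at the boundary `s = b ∈ {0,1}` is `E_3` of the `b`-sections under the ORIGINAL measure. [this work] -/
theorem eval_fibre_boolParam (p : ι → unitInterval) (e : ι) (b : Bool) (U : Fin 3 → Set (Set ι)) :
    (sahiEP (secPoly p e) 3 (fun j => ind (U j))).eval ((boolParam b : unitInterval) : ℝ) =
      sahiE (bernoulliWeight p) 3 (fun j => ind (secAt e b (U j))) := by
  rw [← sahiE_update_eq_eval, sahiE_update_boolParam_eq_secAt, sahiE_secAt_update_eq p e b (boolParam b) (p e), update_eq_self]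

/-- **ONE-COORDINATE DECOMPOSITION of `E_3` under a product measure**:
`E_3(μ_p; U) = (1−p_e)·E_3(μ_p; U^{e←0}) + p_e·E_3(μ_p; U^{e←1}) + p_e(1−p_e)·[(1−p_e)·b₁(e) + p_e·b₂(e)]`. [this work] -/
theorem sahiE_three_decomp_coord (p : ι → unitInterval) (e : ι) (U : Fin 3 → Set (Set ι)) :
    sahiE (bernoulliWeight p) 3 (fun j => ind (U j)) =
      (1 - (p e : ℝ)) * sahiE (bernoulliWeight p) 3 (fun j => ind (secAt e false (U j)))
      + (p e : ℝ) * sahiE (bernoulliWeight p) 3 (fun j => ind (secAt e true (U j)))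
      + (p e : ℝ) * (1 - (p e : ℝ)) * ((1 - (p e : ℝ)) * coordPiece₁ p e U + (p e : ℝ) * coordPiece₂ p e U) := by
  have h0 := eval_fibre_boolParam p e false U
  have h1 := eval_fibre_boolParam p e true U
  have hb0 : ((boolParam false : unitInterval) : ℝ) = 0 := by simp [boolParam]
  have hb1 : ((boolParam true : unitInterval) : ℝ) = 1 := by simp [boolParam]
  rw [hb0] at h0
  rw [hb1] at h1
  have hdeg : (sahiEP (secPoly p e) 3 (fun j => ind (U j))).natDegree ≤ 3 :=
    natDegree_sahiEP_le (secPoly p e) (natDegree_secPoly_le p e) 3 _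
  have hmain := cubic_bernstein_decomp _ hdeg (p e : ℝ)
  rw [h0, h1, ← sahiE_update_eq_eval, update_eq_self] at hmain
  rw [hmain, coordPiece₁, coordPiece₂]

/-- **THE LOCAL STEP**: if both `e`-sections have `E_3 ≥ 0` and `e` is a GOOD coordinate (both Bernstein pieces `≥ 0`), then `E_3(μ_p; U) ≥ 0`. [this work] -/
theorem sahiE_three_nonneg_of_goodCoord (p : ι → unitInterval) (e : ι) (U : Fin 3 → Set (Set ι))
    (hsec0 : 0 ≤ sahiE (bernoulliWeight p) 3 (fun j => ind (secAt e false (U j))))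
    (hsec1 : 0 ≤ sahiE (bernoulliWeight p) 3 (fun j => ind (secAt e true (U j))))
    (hb1 : 0 ≤ coordPiece₁ p e U) (hb2 : 0 ≤ coordPiece₂ p e U) :
    0 ≤ sahiE (bernoulliWeight p) 3 (fun j => ind (U j)) := by
  rw [sahiE_three_decomp_coord p e U]
  have hp0 : 0 ≤ (p e : ℝ) := (p e).2.1
  have hp1 : (p e : ℝ) ≤ 1 := (p e).2.2
  have hq : 0 ≤ 1 - (p e : ℝ) := by linarith
  have ht : 0 ≤ (p e : ℝ) * (1 - (p e : ℝ)) * ((1 - (p e : ℝ)) * coordPiece₁ p e U + (p e : ℝ) * coordPiece₂ p e U) :=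
    mul_nonneg (mul_nonneg hp0 hq) (add_nonneg (mul_nonneg hq hb1) (mul_nonneg hp0 hb2))
  nlinarith [mul_nonneg hq hsec0, mul_nonneg hp0 hsec1]

/-- **CONJECTURE DT-EGC ("doubly-terminal ⇒ exists a good coordinate")**, an obligation of this programme (NOT a published fact): for every product weight
on a finite cube and every triple of up-sets that is FRONTIER-TERMINAL (every maximal non-member of each member lies in the other two) and FLOOR-TERMINAL (no
minimal element of a member lies in both others), some coordinate has both one-coordinate Bernstein pieces `≥ 0`.  With the doubly-terminal reduction
(`SahiFrontierTransfer.sahiPositive_three_iff_doublyTerminal`) and the local step above it implies Kahn's `C_3` by induction on the number of coordinates.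
Census (memo §4.15(c)): ≈ 29 000 (triple, p) cells, `k ≤ 10`, 0 violations; the general (non-terminal) ∃-form is FALSE (hexagon, INEQ-CLAIMS l.363).
[cite: Kahn2022, Conj. 5 (arXiv p. 3)] [status: open] -/
@[conjecture] def DTEGC : Prop :=
  ∀ (ι : Type) [Fintype ι] (p : ι → unitInterval) (W : Fin 3 → Finset (Set ι)),
    (∀ j, IsUpperSet ((W j : Finset (Set ι)) : Set (Set ι))) →
    (∀ j z, z ∉ W j → (∀ y, z < y → y ∈ W j) → ∀ l, l ≠ j → z ∈ W l) →
    (∀ j m, m ∈ W j → (∀ y, y ∈ W j → y ≤ m → y = m) → ∃ l, l ≠ j ∧ m ∉ W l) →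
      ∃ e, 0 ≤ coordPiece₁ p e (fun j => ((W j : Finset (Set ι)) : Set (Set ι))) ∧
        0 ≤ coordPiece₂ p e (fun j => ((W j : Finset (Set ι)) : Set (Set ι)))

/-- **What DT-EGC delivers at one level**: a good coordinate plus nonnegative sections give `E_3 ≥ 0` for a doubly-terminal triple (the local use of the
conjecture; the global induction needs the passage to the sub-cube of the remaining coordinates). [this work] -/
theorem sahiE_three_nonneg_of_DTEGC (h : DTEGC) {ι : Type} [Fintype ι] (p : ι → unitInterval) (W : Fin 3 → Finset (Set ι))
    (hW : ∀ j, IsUpperSet ((W j : Finset (Set ι)) : Set (Set ι)))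
    (hT1 : ∀ j z, z ∉ W j → (∀ y, z < y → y ∈ W j) → ∀ l, l ≠ j → z ∈ W l)
    (hT2 : ∀ j m, m ∈ W j → (∀ y, y ∈ W j → y ≤ m → y = m) → ∃ l, l ≠ j ∧ m ∉ W l)
    (hsec : ∀ (e : ι) (b : Bool), 0 ≤ sahiE (bernoulliWeight p) 3 (fun j => ind (secAt e b ((W j : Finset (Set ι)) : Set (Set ι))))) :
    0 ≤ sahiE (bernoulliWeight p) 3 (fun j => ind ((W j : Finset (Set ι)) : Set (Set ι))) := by
  obtain ⟨e, hb1, hb2⟩ := h ι p W hW hT1 hT2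
  exact sahiE_three_nonneg_of_goodCoord p e _ (hsec e false) (hsec e true) hb1 hb2

end SahiCoordinateBernstein

end Summit.CriticalPhenomena.PercolationContinuityZ3.Theorems
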